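import Summits.Ventures.PercRepro.RankLevelSetPavingBases

/-! # RankLevelSetBiIndepContainNormPaving — EVERY PAVING MATROID SATISFIES THE NORMALIZED CUMULATIVE (CX*) (CUM-norm)
(night-1 g30; dossier §42.18–§42.19)

For a paving matroid of rank `r` (every set with fewer than `r` elements is independent) the contain-`X` profile is
binomial strictly inside its support: for `#E − r < k < r` every `k`-set containing `X` is bi-independent, so
`α^X_k = C(#E − #X, k − #X)` (g28's `biContainCount_eq_choose_of_paving`); at every level `α^X_k ≤ C(#E − #X, k − #X)`
(g28's `biContainCount_le_choose`, any matroid). In a required pair `i < j`, `i + j ≤ N' − 1` (`N' = #E − 2#X`) with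
`α^X_{c+i} > 0` the upper level `c + j` is strictly inside the support, so the normalized inequality
`α^X_{c+i}·C(N', j) ≤ α^X_{c+j}·C(N', i)` reduces to `C(N, i)·C(N', j) ≤ C(N, j)·C(N', i)` for `N' ≤ N = #E − #X`
(**`chooseRatio_mono_of_le`**: the ratio `C(N, j)/C(N', j)` is nondecreasing in `j`). Hence
**`biContainNormSkew_of_paving'`**: (CUM-norm) on every paving matroid, in the unfolded form (the `Prop`
`BiContainNormSkew` of `RankLevelSetBiIndepContainNorm` is this statement verbatim). Every declaration has a docstring;
imports: the cell's own modules and Mathlib only. Axioms: standard. -/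

namespace PercRepro

open Set Matroid

variable {α : Type} (M : Matroid α) [M.Finite]

omit [M.Finite] in
/-- **The ratio `C(N, j)/C(N', j)` is nondecreasing in `j`** for `N' ≤ N` (one step, cross-multiplied). -/
lemma chooseRatio_mono_succ {N N' j : ℕ} (h : N' ≤ N) :
    N.choose j * N'.choose (j + 1) ≤ N.choose (j + 1) * N'.choose j := by
  have h1 := Nat.choose_succ_right_eq N j
  have h2 := Nat.choose_succ_right_eq N' j
  -- multiply both sides by `(j + 1)`
  refine Nat.le_of_mul_le_mul_right (a := N.choose j * N'.choose (j + 1)) (b := N.choose (j + 1) * N'.choose j)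
    (c := j + 1) ?_ (Nat.succ_pos j)
  calc N.choose j * N'.choose (j + 1) * (j + 1) = N.choose j * (N'.choose (j + 1) * (j + 1)) := by ring
    _ = N.choose j * (N'.choose j * (N' - j)) := by rw [h2]
    _ ≤ N.choose j * (N'.choose j * (N - j)) := by
        apply Nat.mul_le_mul_left
        apply Nat.mul_le_mul_left
        omega
    _ = N.choose j * (N - j) * N'.choose j := by ring
    _ = N.choose (j + 1) * (j + 1) * N'.choose j := by rw [h1]
    _ = N.choose (j + 1) * N'.choose j * (j + 1) := by ring

omit [M.Finite] in
/-- **The ratio `C(N, j)/C(N', j)` is nondecreasing in `j`** for `N' ≤ N`, across a gap `i ≤ j ≤ N'`. -/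
lemma chooseRatio_mono_of_le {N N' i j : ℕ} (h : N' ≤ N) (hij : i ≤ j) (hj : j ≤ N') :
    N.choose i * N'.choose j ≤ N.choose j * N'.choose i := by
  obtain ⟨s, rfl⟩ := Nat.exists_eq_add_of_le hij
  induction s with
  | zero => simp
  | succ s ih =>
    have ih' := ih (by omega) (by omega)
    rw [← Nat.add_assoc]
    have hstep := chooseRatio_mono_succ (N := N) (N' := N') (j := i + s) h
    have hpos : 0 < N.choose (i + s) * N'.choose (i + s) :=
      Nat.mul_pos (Nat.choose_pos (by omega)) (Nat.choose_pos (by omega))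
    refine Nat.le_of_mul_le_mul_right (c := N.choose (i + s) * N'.choose (i + s)) ?_ hpos
    calc N.choose i * N'.choose (i + s + 1) * (N.choose (i + s) * N'.choose (i + s))
        = (N.choose i * N'.choose (i + s)) * (N.choose (i + s) * N'.choose (i + s + 1)) := by ring
      _ ≤ (N.choose (i + s) * N'.choose i) * (N.choose (i + s + 1) * N'.choose (i + s)) :=
          Nat.mul_le_mul ih' hstep
      _ = N.choose (i + s + 1) * N'.choose i * (N.choose (i + s) * N'.choose (i + s)) := by ring

/-- **EVERY PAVING MATROID SATISFIES (CUM-norm)** (unfolded form): for `X ⊆ E`, `c = #X`, `N' = #E − 2c`, and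
`i < j` with `i + j + 1 ≤ N'`: `α^X_{c+i}·C(N', j) ≤ α^X_{c+j}·C(N', i)`. -/
theorem biContainNormSkew_of_paving' (h : Paving M) {r : ℕ} (hr : M.eRank = r) :
    ∀ X ⊆ M.E, ∀ i j : ℕ, i < j → i + j + 1 ≤ M.E.ncard - 2 * X.ncard →
      biContainCount M X (X.ncard + i) * (M.E.ncard - 2 * X.ncard).choose j ≤
        biContainCount M X (X.ncard + j) * (M.E.ncard - 2 * X.ncard).choose i := by
  intro X hX i j hij hR
  have hXE : X.ncard ≤ M.E.ncard := Set.ncard_le_ncard hX M.ground_finite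
  rcases Nat.eq_zero_or_pos (biContainCount M X (X.ncard + i)) with h0 | hpos
  · rw [h0, Nat.zero_mul]
    exact Nat.zero_le _
  -- a bi-independent set at level `c + i` exists: `#E − r ≤ c + i` and `c + i ≤ r`
  have hne : {Z ∈ biIndep M (X.ncard + i) | X ⊆ Z}.Nonempty :=
    Set.nonempty_of_ncard_ne_zero (by unfold biContainCount at hpos; omega)
  obtain ⟨Z, ⟨hZE, hZk, hZi, hZc⟩, -⟩ := hne
  have hr' : M.eRank = r := hr
  have hZr : Z.ncard ≤ r := by
    have := hZi.encard_le_eRank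
    rw [← Set.Finite.cast_ncard_eq (M.ground_finite.subset hZE), hr'] at this
    exact_mod_cast this
  have hZc' : (M.E \ Z).ncard ≤ r := by
    have := hZc.encard_le_eRank
    rw [← Set.Finite.cast_ncard_eq (M.ground_finite.subset Set.sdiff_subset), hr'] at this
    exact_mod_cast this
  rw [Set.ncard_sdiff' hZE M.ground_finite] at hZc'
  -- the upper level `c + j` lies strictly inside the support
  have hj := biContainCount_eq_choose_of_paving M h hX (k := X.ncard + j) (by omega)
    (by rw [hr]; exact_mod_cast (by omega : X.ncard + j < r))
    (by rw [hr]; exact_mod_cast (by omega : M.E.ncard - (X.ncard + j) < r))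
  have hi := biContainCount_le_choose M hX (k := X.ncard + i) (by omega)
  rw [hj, Nat.add_sub_cancel_left]
  rw [Nat.add_sub_cancel_left] at hi
  calc biContainCount M X (X.ncard + i) * (M.E.ncard - 2 * X.ncard).choose j
      ≤ (M.E.ncard - X.ncard).choose i * (M.E.ncard - 2 * X.ncard).choose j := Nat.mul_le_mul_right _ hi
    _ ≤ (M.E.ncard - X.ncard).choose j * (M.E.ncard - 2 * X.ncard).choose i :=
        chooseRatio_mono_of_le (by omega) hij.le (by omega)

end PercRepro
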